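import Literature.Analysis.Complex.CahenMellinDirichlet
import Literature.Analysis.Complex.RectangleNested
import Literature.Analysis.Complex.VerticalLineIntegrals
import HarnessLib

/-!
# Tools for Hamburger's theorem, I: Cahen–Mellin for theta series and the strip-with-hole shift

Support file for the discharge of `Literature.Barriers.RiemannHypothesis.Hamburger`
(Titchmarsh, *The Theory of the Riemann Zeta-Function*, §2.13). Everything here is PROVED.
-/

noncomputable section

open _root_.Complex Set MeasureTheory Filter intervalIntegral Real
open scoped _root_.Topology

namespace Literature.Barriers.RiemannHypothesis

namespace Hamburger1921

open Literature.Analysis.Complex Literature.Analysis.SpecialFunctions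

/-! ### `Γ` on vertical lines `re s = c > 0` -/

/-- **`y ↦ Γ(c + iy)` is integrable on `ℝ` for every `c > 0`** (for `c ≤ 2` the tree's
`integrable_Gamma_vertical`; for `c > 2` write `c = x + n`, `x ∈ [1,2)`, and use
`‖Γ(x + n + iu)‖ ≤ 16π²(1+|u|)^{3/2}e^{−π|u|/2}∏_{k<n}(x+k+|u|)`). [folklore] -/
theorem integrable_Gamma_vertical_of_pos {c : ℝ} (hc : 0 < c) :
    Integrable fun y : ℝ ↦ Complex.Gamma (c + y * I) := by
  rcases le_or_gt c 2 with hc2 | hc2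
  · exact integrable_Gamma_vertical hc hc2
  -- continuity on the line (as in the tree's `continuous_Gamma_line`)
  have hcont : Continuous fun y : ℝ ↦ Complex.Gamma (c + y * I) := by
    refine continuous_iff_continuousAt.2 fun y ↦ ?_
    have hΓ : DifferentiableAt ℂ Complex.Gamma ((c : ℂ) + y * I) := by
      refine Complex.differentiableAt_Gamma _ fun m h ↦ ?_
      have h1 := congrArg Complex.re h
      simp only [add_re, ofReal_re, mul_re, I_re, mul_zero, ofReal_im, I_im, mul_one, sub_self,
        add_zero, neg_re, natCast_re] at h1
      have : (0 : ℝ) ≤ m := Nat.cast_nonneg m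
      linarith
    exact ContinuousAt.comp (f := fun y : ℝ ↦ (c : ℂ) + y * I) hΓ.continuousAt (by fun_prop)
  set n : ℕ := ⌊c⌋₊ - 1 with hn
  have hfl : 1 ≤ ⌊c⌋₊ := Nat.le_floor (by norm_num; linarith)
  have hnR : (n : ℝ) = ⌊c⌋₊ - 1 := by
    rw [hn, Nat.cast_sub hfl]; norm_num
  set x : ℝ := c - n with hx
  have hx1 : 1 ≤ x := by
    have := Nat.floor_le (by linarith : (0 : ℝ) ≤ c); rw [hx, hnR]; linarith
  have hx2 : x ≤ 2 := by
    have := Nat.lt_floor_add_one c; rw [hx, hnR]; linarith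
  have hcx : x + n = c := by rw [hx]; ring
  have hxn : 1 ≤ x + n := by rw [hcx]; linarith
  have hpi : 0 < π / 2 := by positivity
  set K : ℝ := 16 * π ^ 2 * (x + n) ^ n with hK
  have hbound : ∀ u : ℝ, ‖Complex.Gamma (c + u * I)‖ ≤
      K * ((1 + |u|) ^ ((n : ℝ) + 3 / 2) * Real.exp (-(π / 2 * |u|))) := by
    intro u
    have h := norm_Gamma_add_nat_le hx1 hx2 n u
    rw [hcx] at h
    have hu : 0 ≤ |u| := abs_nonneg u
    have hprod : ∏ k ∈ Finset.range n, (x + k + |u|) ≤ ((x + n) * (1 + |u|)) ^ n := by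
      rw [← Finset.card_range n, ← Finset.prod_const, Finset.card_range]
      refine Finset.prod_le_prod (fun k _ ↦ by positivity) fun k hk ↦ ?_
      have hk' : (k : ℝ) ≤ n := by exact_mod_cast (Finset.mem_range.1 hk).le
      nlinarith
    have he : Real.exp (-(π * |u|) / 2) = Real.exp (-(π / 2 * |u|)) := by congr 1; ring
    have hsplit : (1 + |u|) ^ ((n : ℝ) + 3 / 2) = (1 + |u|) ^ n * (1 + |u|) ^ (3 / 2 : ℝ) := by
      rw [Real.rpow_add (by positivity), Real.rpow_natCast]
    calc ‖Complex.Gamma (c + u * I)‖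
        ≤ 16 * π ^ 2 * (1 + |u|) ^ (3 / 2 : ℝ) * Real.exp (-(π * |u|) / 2) *
            ∏ k ∈ Finset.range n, (x + k + |u|) := h
      _ ≤ 16 * π ^ 2 * (1 + |u|) ^ (3 / 2 : ℝ) * Real.exp (-(π * |u|) / 2) *
            ((x + n) * (1 + |u|)) ^ n := by gcongr
      _ = K * ((1 + |u|) ^ ((n : ℝ) + 3 / 2) * Real.exp (-(π / 2 * |u|))) := by
          rw [he, hsplit, mul_pow, hK]; ring
  have hdom := (integrable_one_add_abs_rpow_mul_exp_neg hpi
    (by positivity : (0 : ℝ) ≤ (n : ℝ) + 3 / 2)).const_mul K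
  exact hdom.mono' hcont.aestronglyMeasurable
    (Eventually.of_forall hbound)

/-- **Cahen–Mellin integral** for every abscissa `c > 0`: for `x > 0`,
`(1/2π) ∫ x^{−(c+iy)} Γ(c+iy) dy = e^{−x}` (the tree's `exp_neg_eq_mellinInv_Gamma` without the
restriction `c ≤ 2`). [folklore] -/
theorem exp_neg_eq_mellinInv_Gamma_of_pos {c : ℝ} (hc : 0 < c) {x : ℝ} (hx : 0 < x) :
    (1 / (2 * π) : ℂ) * ∫ y : ℝ, (x : ℂ) ^ (-(c + y * I)) * Complex.Gamma (c + y * I) =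
      Real.exp (-x) := by
  set f : ℝ → ℂ := fun t ↦ (Real.exp (-t) : ℂ) with hf
  have hmel : ∀ y : ℝ, mellin f (c + y * I) = Complex.Gamma (c + y * I) := fun y ↦ by
    rw [hf, ← congrFun Complex.GammaIntegral_eq_mellin, ← Complex.Gamma_eq_integral (by simp [hc])]
  have hconv : MellinConvergent f c := by
    have h := Complex.GammaIntegral_convergent (s := c) (by simp [hc])
    refine (h.congr_fun (fun t _ ↦ ?_) measurableSet_Ioi)
    simp only [hf, smul_eq_mul]
    push_cast
    ring
  have hvert : VerticalIntegrable (mellin f) c := by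
    unfold VerticalIntegrable
    exact (integrable_Gamma_vertical_of_pos hc).congr (Eventually.of_forall fun y ↦ (hmel y).symm)
  have hcont : ContinuousAt f x := by
    have : Continuous f := by rw [hf]; fun_prop
    exact this.continuousAt
  have h := mellinInv_mellin_eq c f hx hconv hvert hcont
  rw [mellinInv, Complex.real_smul] at h
  have key : (1 / (2 * π) : ℂ) * ∫ y : ℝ, (x : ℂ) ^ (-(c + y * I)) * Complex.Gamma (c + y * I) =
      f x := by
    rw [← h]
    push_cast
    congr 1
    refine integral_congr_ae (Eventually.of_forall fun y ↦ ?_)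
    simp only [smul_eq_mul, hmel y]
  rw [key]

/-! ### The theta series of a Dirichlet series as a vertical integral -/

/-- The terms: for `n ≥ 1`, `x > 0`, `c > 0`,
`a(n) e^{−πn²x} = (1/2π) ∫ a(n) n^{−2(c+iy)} · (πx)^{−(c+iy)} Γ(c+iy) dy`
(Cahen–Mellin at `πn²x` and `(πn²x)^{−w} = n^{−2w}(πx)^{−w}`). [folklore] -/
theorem mul_exp_neg_pi_sq_eq_integral_term (a : ℕ → ℂ) {c : ℝ} (hc : 0 < c) {x : ℝ}
    (hx : 0 < x) (n : ℕ) :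
    (if n = 0 then 0 else a n * (Real.exp (-(π * n ^ 2 * x)) : ℂ)) =
      (1 / (2 * π) : ℂ) * ∫ y : ℝ, LSeries.term a (2 * (c + y * I)) n *
        (((π * x : ℝ) : ℂ) ^ (-(c + y * I)) * Complex.Gamma (c + y * I)) := by
  rcases eq_or_ne n 0 with rfl | hn
  · simp
  simp only [hn, if_false]
  have hn0 : (0 : ℝ) < n := by exact_mod_cast Nat.pos_of_ne_zero hn
  have hπx : 0 < π * x := mul_pos Real.pi_pos hx
  -- Cahen–Mellin at `π n² x = (n·n)·(πx)`
  have h := exp_neg_eq_mellinInv_Gamma_of_pos hc (x := (n : ℝ) * n * (π * x)) (by positivity)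
  have e1 : (Real.exp (-(π * n ^ 2 * x)) : ℂ) = (Real.exp (-((n : ℝ) * n * (π * x))) : ℂ) := by
    congr 1; ring_nf
  rw [e1, ← h, ← mul_assoc, mul_comm (a n), mul_assoc, ← MeasureTheory.integral_const_mul]
  congr 1
  refine integral_congr_ae (Eventually.of_forall fun y ↦ ?_)
  simp only
  have hnC : (n : ℂ) ≠ 0 := by exact_mod_cast hn
  have e2 : (((n : ℝ) * n * (π * x) : ℝ) : ℂ) = (((n : ℝ) * n : ℝ) : ℂ) * ((π * x : ℝ) : ℂ) := by
    push_cast; ring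
  have e3 : (((n : ℝ) * n : ℝ) : ℂ) = ((n : ℝ) : ℂ) * ((n : ℝ) : ℂ) := by push_cast; ring
  rw [e2, Complex.mul_cpow_ofReal_nonneg (mul_nonneg hn0.le hn0.le) hπx.le, e3,
    Complex.mul_cpow_ofReal_nonneg hn0.le hn0.le, Complex.ofReal_natCast,
    ← Complex.cpow_add _ _ hnC, LSeries.term_of_ne_zero hn,
    show -((c : ℂ) + y * I) + -((c : ℂ) + y * I) = -(2 * ((c : ℂ) + y * I)) by ring,
    Complex.cpow_neg, div_eq_mul_inv]
  ring

/-- **Heat-kernel (Cahen–Mellin) representation of the theta series of a Dirichlet series.** If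
`∑ a(n) n^{−s}` is absolutely summable at `s = 2c`, `c > 0`, then for `x > 0`
`∑_{n ≥ 1} a(n) e^{−πn²x} = (1/2π) ∫ L(a, 2(c+iy)) (πx)^{−(c+iy)} Γ(c+iy) dy`
(Titchmarsh §2.13, first display; termwise Cahen–Mellin, `∑ ∫ = ∫ ∑` by absolute convergence).
[cite: Titchmarsh1986, §2.13] -/
theorem tsum_mul_exp_neg_pi_sq_eq_integral (a : ℕ → ℂ) {c : ℝ} (hc : 0 < c)
    (hsum : LSeriesSummable a (2 * c)) {x : ℝ} (hx : 0 < x) :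
    ∑' n : ℕ, (if n = 0 then 0 else a n * (Real.exp (-(π * n ^ 2 * x)) : ℂ)) =
      (1 / (2 * π) : ℂ) * ∫ y : ℝ, LSeries a (2 * (c + y * I)) *
        (((π * x : ℝ) : ℂ) ^ (-(c + y * I)) * Complex.Gamma (c + y * I)) := by
  have hΓ := integrable_Gamma_vertical_of_pos hc
  have hπx : 0 < π * x := mul_pos Real.pi_pos hx
  set G : ℕ → ℝ → ℂ := fun n y ↦ LSeries.term a (2 * (c + y * I)) n *
    (((π * x : ℝ) : ℂ) ^ (-(c + y * I)) * Complex.Gamma (c + y * I)) with hG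
  have hre : ∀ y : ℝ, (-((c : ℂ) + y * I)).re = -c := by intro y; simp
  have hnormterm : ∀ (n : ℕ) (y : ℝ),
      ‖LSeries.term a (2 * ((c : ℂ) + y * I)) n‖ = ‖LSeries.term a (2 * c) n‖ := by
    intro n y
    simp [LSeries.norm_term_eq]
  have hnormG : ∀ n y, ‖G n y‖ =
      ‖LSeries.term a (2 * c) n‖ * ((π * x) ^ (-c) * ‖Complex.Gamma (c + y * I)‖) := by
    intro n y
    simp only [hG, norm_mul]
    rw [Complex.norm_cpow_eq_rpow_re_of_pos hπx, hnormterm, hre]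
  have hcontw : Continuous fun y : ℝ ↦ ((π * x : ℝ) : ℂ) ^ (-(c + y * I)) :=
    Continuous.const_cpow (by fun_prop) (Or.inl (by exact_mod_cast hπx.ne'))
  have hcontn : ∀ n : ℕ, Continuous fun y : ℝ ↦ LSeries.term a (2 * (c + y * I)) n := by
    intro n
    rcases eq_or_ne n 0 with rfl | hn
    · simp only [LSeries.term_zero]; exact continuous_const
    · simp only [LSeries.term_of_ne_zero hn, div_eq_mul_inv]
      refine continuous_const.mul (Continuous.inv₀ ?_ fun y ↦ ?_)
      · exact Continuous.const_cpow (by fun_prop) (Or.inl (by exact_mod_cast hn))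
      · exact (Complex.cpow_ne_zero_iff_of_exponent_ne_zero (by
          intro h0; have := congrArg Complex.re h0; simp at this; linarith)).2
          (by exact_mod_cast hn)
  have hint : ∀ n, Integrable (G n) := by
    intro n
    have h := hΓ.bdd_mul (((hcontn n).mul hcontw).aestronglyMeasurable)
      (c := ‖LSeries.term a (2 * c) n‖ * (π * x) ^ (-c)) (Eventually.of_forall fun y ↦ ?_)
    · refine h.congr (Eventually.of_forall fun y ↦ ?_)
      simp only [hG, Pi.mul_apply]; ring
    · simp only [Pi.mul_apply]
      rw [norm_mul, Complex.norm_cpow_eq_rpow_re_of_pos hπx, hnormterm, hre]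
  have hnormint : ∀ n, ∫ y, ‖G n y‖ = ‖LSeries.term a (2 * c) n‖ * ((π * x) ^ (-c) *
      ∫ y : ℝ, ‖Complex.Gamma (c + y * I)‖) := by
    intro n
    simp_rw [hnormG]
    rw [MeasureTheory.integral_const_mul, MeasureTheory.integral_const_mul]
  have hsumm : Summable fun n ↦ ∫ y, ‖G n y‖ := by
    simp_rw [hnormint]
    exact (summable_norm_iff.2 hsum).mul_right _
  calc ∑' n : ℕ, (if n = 0 then 0 else a n * (Real.exp (-(π * n ^ 2 * x)) : ℂ))
      = ∑' n : ℕ, (1 / (2 * π) : ℂ) * ∫ y : ℝ, G n y :=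
        tsum_congr fun n ↦ mul_exp_neg_pi_sq_eq_integral_term a hc hx n
    _ = (1 / (2 * π) : ℂ) * ∑' n : ℕ, ∫ y : ℝ, G n y := tsum_mul_left
    _ = (1 / (2 * π) : ℂ) * ∫ y : ℝ, ∑' n : ℕ, G n y := by
        rw [integral_tsum_of_summable_integral_norm hint hsumm]
    _ = _ := by
        congr 1
        refine integral_congr_ae (Eventually.of_forall fun y ↦ ?_)
        simp only [hG]
        rw [tsum_mul_right, LSeries]

/-! ### Shifting a vertical line across a strip with finitely many singularities boxed away -/

/-- **Shifting a line of integration across a strip, keeping a rectangle of singularities.**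
Let `a < b`, `T > 0`, and let `F` be complex differentiable on the closed strip `a ≤ re s ≤ b`
minus the open box `(a,b) × (−T,T)`, absolutely integrable along `re s = a` and `re s = b`, and
uniformly small on the horizontal cross-sections as `|im s| → ∞`. Then
`i∫ F(b + yi) dy − i∫ F(a + yi) dy = ∮_{∂([a,b]×[−T,T])} F`
(Cauchy's theorem for the rectangular annuli `[a,b] × [−T',T'] ∖ (a,b) × (−T,T)` and `T' → ∞`);
with the residue theorem inside the box this is the usual "line shift = sum of residues", but no
knowledge of the singularities inside the box is required. [folklore] -/
theorem integral_vertical_sub_eq_rectBoundaryIntegral {F : ℂ → ℂ} {a b T : ℝ} (hab : a < b)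
    (hT : 0 < T)
    (hF : DifferentiableOn ℂ F ((re ⁻¹' Icc a b) \ (Ioo a b ×ℂ Ioo (-T) T)))
    (ha : Integrable fun y : ℝ ↦ F (a + y * I))
    (hb : Integrable fun y : ℝ ↦ F (b + y * I))
    (hdecay : ∀ ε : ℝ, 0 < ε → ∃ T₀ : ℝ, ∀ T' : ℝ, T₀ ≤ |T'| → ∀ x ∈ Icc a b,
      ‖F (x + T' * I)‖ ≤ ε) :
    I * (∫ y : ℝ, F (b + y * I)) - I * (∫ y : ℝ, F (a + y * I)) =
      rectBoundaryIntegral F a b (-T) T := by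
  -- the boundary integral over `[a,b] × [-T',T']` does not depend on `T' ≥ T`
  have hconst : ∀ T' : ℝ, T ≤ T' →
      rectBoundaryIntegral F a b (-T') T' = rectBoundaryIntegral F a b (-T) T := by
    intro T' hT'
    refine rectBoundaryIntegral_eq_of_differentiableOn_annulus le_rfl hab le_rfl (by linarith)
      (by linarith) hT' (hF.mono fun z hz ↦ ⟨?_, hz.2⟩)
    exact (mem_reProdIm.1 hz.1).1
  -- the vertical sides converge to the full line integrals, the horizontal sides to zero
  have hright : Tendsto (fun T' : ℝ ↦ ∫ y in (-T')..T', F (b + y * I)) atTop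
      (𝓝 (∫ y : ℝ, F (b + y * I))) :=
    intervalIntegral_tendsto_integral hb tendsto_neg_atTop_atBot tendsto_id
  have hleft : Tendsto (fun T' : ℝ ↦ ∫ y in (-T')..T', F (a + y * I)) atTop
      (𝓝 (∫ y : ℝ, F (a + y * I))) :=
    intervalIntegral_tendsto_integral ha tendsto_neg_atTop_atBot tendsto_id
  have hhor : ∀ s : ℝ, (s = 1 ∨ s = -1) →
      Tendsto (fun T' : ℝ ↦ ∫ x in a..b, F (x + ((s * T' : ℝ) : ℂ) * I)) atTop (𝓝 0) := by
    intro s hs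
    rw [Metric.tendsto_atTop]
    intro ε hε
    set ε' : ℝ := ε / (2 * (b - a)) with hε'
    have hba : 0 < b - a := sub_pos.2 hab
    have hε'0 : 0 < ε' := div_pos hε (by positivity)
    obtain ⟨T₀, hT₀⟩ := hdecay ε' hε'0
    refine ⟨max T₀ 0, fun T' hT' ↦ ?_⟩
    have hT0 : 0 ≤ T' := le_of_max_le_right hT'
    have habs : T₀ ≤ |s * T'| := by
      rcases hs with rfl | rfl
      · rw [one_mul, abs_of_nonneg hT0]; exact le_of_max_le_left hT'
      · rw [neg_one_mul, abs_neg, abs_of_nonneg hT0]; exact le_of_max_le_left hT'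
    rw [dist_zero_right]
    have h1 : ‖∫ x in a..b, F (x + ((s * T' : ℝ) : ℂ) * I)‖ ≤ ε' * |b - a| :=
      norm_integral_le_of_norm_le_const fun x hx ↦
        hT₀ (s * T') habs x (by rw [uIoc_of_le hab.le] at hx; exact ⟨hx.1.le, hx.2⟩)
    rw [abs_of_nonneg hba.le] at h1
    calc ‖∫ x in a..b, F (x + ((s * T' : ℝ) : ℂ) * I)‖ ≤ ε' * (b - a) := h1
      _ < ε := by
          rw [hε', div_mul_eq_mul_div, div_lt_iff₀ (by positivity)]
          nlinarith
  have hlim : Tendsto (fun T' : ℝ ↦ rectBoundaryIntegral F a b (-T') T') atTop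
      (𝓝 ((0 - 0) + I * (∫ y : ℝ, F (b + y * I)) - I * (∫ y : ℝ, F (a + y * I)))) := by
    have hbot := hhor (-1) (Or.inr rfl)
    have htop := hhor 1 (Or.inl rfl)
    simp only [neg_one_mul, one_mul] at hbot htop
    refine ((hbot.sub htop).add (hright.const_mul I)).sub (hleft.const_mul I) |>.congr' ?_
    exact Eventually.of_forall fun T' ↦ by simp [rectBoundaryIntegral]
  have hlim' : Tendsto (fun T' : ℝ ↦ rectBoundaryIntegral F a b (-T') T') atTop
      (𝓝 (rectBoundaryIntegral F a b (-T) T)) :=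
    tendsto_const_nhds.congr' (eventuallyEq_of_mem (Ici_mem_atTop T) fun T' hT' ↦
      (hconst T' hT').symm)
  have := tendsto_nhds_unique hlim' hlim
  rw [this]; ring

end Hamburger1921

end Literature.Barriers.RiemannHypothesis
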